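/-
Copyright: the b2b-balaban cell (near-miss cell 7), T⁴-continuum fan-out, NE7b ROUND-2 swarm `t4-ne7b-formalise-*`
(seat leaf-07, gen 2), row S6 pt 3b «zones of realised histories» AT LEVELS (owner's ruling R-OWNER-22-15; the
tolerant reading T-a of R-OWNER-22-12) of lineage t4-ne7b-p1's claim table `LEAVES-NE7b.md`.  Part 3b-I: the torus
transport of S-image orbits.
Released under the licence of the surrounding project.
-/
import Summits.QuantumFields.BalabanUV.T4Continuum.Support.HistoryZonesDropsRegions
import Summits.QuantumFields.BalabanUV.T4Continuum.Support.HistoryRealiseCells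

/-!
# History zones from orbits, I: the S-image orbit of a birth region, reduced to the torus, lies in its levelled zone

Summits-side support leaf of the T⁴-continuum cell (rung (B)+1 on a FINITE torus only; NOT infinite volume, NOT the
mass gap, NOT the Clay statement; NOT a proof of the spine estimate NE7b).  Row S6 pt 3b (reassigned to this seat by
R-OWNER-22-15): the ZONE READING of a REALISED history (leaf-08's `HistoryRealise.Realises`: birth regions, S-image
orbits `orbit L s t₀ Z l = Siter (ratio L (s ∘ (t₀ + ·))) l Z`, joins on `Touch`) must inhabit the levelled tolerant
reading `HistoryZonesDropsRegions.BirthRegionsD` (zones = `c`-thickened LEVELLED blockings of the reduced birth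
regions).  The orbit already runs at the true per-step ratios `L^{lv (t+1) − lv t}` (`B16SProfile.ratio`, window drops
included), so its natural home is the LEVELLED zone with `lv := HistoryLevels.levelOf s K` — not a step-indexed one.
This file is the ℤ^d → torus transport; part II (`HistoryZonesOrbitRealise.lean`) walks `Realises`.

WHAT ([folklore] finite geometry on the lineage's OWN index model; nothing is quoted from print, nothing printed is
asserted, no `[cite:]` tag, no `Prop` fact minted).  §1 reduction mod `m` (`ZoneBirthExtent.res`∕`redZone`) against the
torus operations: `redZone_mono`, `redZone_union`∕`redZone_biUnion`, **`redZone_box_subset_thickT`** (a box of index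
radius `r` reduces into the `r`-thickening of its reduced centre — `cycd_res_le_natAbs`), **`res_coarse`** ∕
**`redZone_closureIdx`** (reducing mod `m` after coarsening by `q` = blocking by `q` after reducing mod `m·q` — Euclidean
division), `redZone_singleton_subset` (the S-iterates' monotonicity ∕ union law are the tree's `SpaceTimePeierls.Siter_mono` ∕
`B16MergeGeometry.Siter_union`, used in part II).  §2 **`redZone_Siter_subset_thickT`**: under drop control and `3 ≤ L`, the reduced `l`-th S-image of `Z`
lies in `thickT m 31 (blocks (Qfrom L s j l) (redZone (m·Qfrom) Z))` (`B16SProfile.Siter_subset_biUnion_box`: «S^{n−j}(Z) ⊂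
⋃ □₀^{~31}», p. 384 — the kernel-checked index-model form, CONTEXT for the constant `31`); §3 AT LEVELS
**`redZone_orbit_subset`**: for stepwise non-increasing, drop-controlled exponents and `j ≤ t ≤ K`, with `lv := levelOf s K`,
`redZone (n·L^{K − lv t}) (orbit L s j Z (t − j)) ⊆ thickT (n·L^{K − lv t}) 31 (blocks (L^{lv t − lv j}) (redZone (n·L^{K −
lv j}) Z))` — i.e. inside `regZoneD … 31 …` of a bare birth with region `redZone (n·L^{K − lv j}) Z`
(`HistoryRealiseCells.Qfrom_eq_pow_levelOf_sub`, leaf-08 g2).  §4 sanity.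

HONEST DEPENDENCY (cell): continuum YM on T⁴ ⇐ BetaPertH ∧ nine spine estimates (0/9 proved); BetaPertH ⇐ (D1) ∧ (D4)
∧ CAP+tail; G-an2-4 gates asym, D1 and NE2/3/4.  This file changes none of it.  NE7b NOT proved.
-/

open Finset
open Literature.MathematicalPhysics.QuantumFieldTheory.Balaban1983to89
open Literature.MathematicalPhysics.QuantumFieldTheory.Balaban1983to89.B13ScaleTransfer
open Literature.MathematicalPhysics.QuantumFieldTheory.Balaban1983to89.B16SProfile
open Summit.QuantumFields.BalabanUV.T4Continuum.ZoneTorus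
open Summit.QuantumFields.BalabanUV.T4Continuum.HistoryRealise
open Summit.QuantumFields.BalabanUV.T4Continuum.HistoryRealiseCells

namespace Summit.QuantumFields.BalabanUV.T4Continuum.HistoryZones

noncomputable section

variable {d : ℕ}

/-! ## §1 Reduction mod `m` against the torus operations -/

/-- reduction is monotone [folklore] -/
theorem redZone_mono (m : ℕ) {Z Z' : Finset (Pt d)} (h : Z ⊆ Z') : redZone m Z ⊆ redZone m Z' :=
  image_subset_image h

/-- reduction distributes over unions [folklore] -/
theorem redZone_union (m : ℕ) (Z Z' : Finset (Pt d)) : redZone m (Z ∪ Z') = redZone m Z ∪ redZone m Z' :=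
  image_union _ _

/-- reduction distributes over indexed unions [folklore] -/
theorem redZone_biUnion {α : Type*} [DecidableEq α] (m : ℕ) (S : Finset α) (t : α → Finset (Pt d)) :
    redZone m (S.biUnion t) = S.biUnion fun a => redZone m (t a) := by
  unfold redZone
  rw [biUnion_image]

/-- **A BOX REDUCES INTO THE THICKENING OF ITS REDUCED CENTRE**: `redZone m (box c r) ⊆ thickT m r (redZone m {c})`
(reduction does not increase distances). [folklore] -/
theorem redZone_box_subset_thickT {m : ℕ} (hm : 0 < m) (c : Pt d) (r : ℕ) :
    redZone m (box c r) ⊆ thickT m r (redZone m {c}) := by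
  intro u hu
  obtain ⟨y, hy, rfl⟩ := mem_image.1 hu
  refine mem_thickT.2 ⟨fun i => res_lt hm (y i), fun i => res m (c i), ?_, ?_⟩
  · exact mem_image.2 ⟨c, mem_singleton_self c, rfl⟩
  · refine cdist_red_le hm y c r fun i => ?_
    obtain ⟨h1, h2⟩ := mem_box.1 hy i
    omega

/-- the reduced centre lies in the reduction of any family containing it [folklore] -/
theorem redZone_singleton_subset (m : ℕ) {c : Pt d} {Z : Finset (Pt d)} (hc : c ∈ Z) :
    redZone m {c} ⊆ redZone m Z :=
  redZone_mono m (singleton_subset_iff.2 hc)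

/-- **REDUCING AFTER COARSENING = BLOCKING AFTER REDUCING** (one coordinate): for `m, q > 0`,
`res m (x ∕ q) = res (m·q) x ∕ q` (Euclidean division on `ℤ`, then on `ℕ`). [folklore] -/
theorem res_coarse {m q : ℕ} (hm : 0 < m) (hq : 0 < q) (x : ℤ) : res m (x / (q : ℤ)) = res (m * q) x / q := by
  have hM : (0 : ℤ) < m := by exact_mod_cast hm
  have hQ : (0 : ℤ) < q := by exact_mod_cast hq
  have hMQ : (0 : ℤ) < (m : ℤ) * q := mul_pos hM hQ
  set y : ℤ := x % ((m : ℤ) * q) with hy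
  set k : ℤ := x / ((m : ℤ) * q) with hk
  have hy0 : 0 ≤ y := Int.emod_nonneg _ hMQ.ne'
  have hy1 : y < (m : ℤ) * q := Int.emod_lt_of_pos _ hMQ
  have hx : x = y + ((m : ℤ) * k) * q := by
    have h := Int.emod_def x ((m : ℤ) * q)
    rw [← hk, ← hy] at h
    linear_combination -h
  -- `x ∕ q = y ∕ q + m·k`, and `y ∕ q ∈ [0, m)`
  have hdiv : x / (q : ℤ) = y / (q : ℤ) + (m : ℤ) * k := by
    rw [hx, Int.add_mul_ediv_right _ _ hQ.ne']
  have hyq0 : 0 ≤ y / (q : ℤ) := Int.ediv_nonneg hy0 hQ.le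
  have hyq1 : y / (q : ℤ) < m := Int.ediv_lt_of_lt_mul hQ hy1
  have hmod : x / (q : ℤ) % (m : ℤ) = y / (q : ℤ) := by
    rw [hdiv, mul_comm (m : ℤ) k, Int.add_mul_emod_self_right, Int.emod_eq_of_lt hyq0 hyq1]
  -- both sides as naturals
  have hres : res (m * q) x = y.toNat := by simp [res, hy]
  rw [res, hmod, hres]
  obtain ⟨n, hn⟩ : ∃ n : ℕ, y = n := ⟨y.toNat, (Int.toNat_of_nonneg hy0).symm⟩
  rw [hn, Int.toNat_natCast, ← Int.natCast_div, Int.toNat_natCast]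

/-- **REDUCING A COARSENED FAMILY = BLOCKING THE REDUCED FAMILY**: `redZone m (closureIdx q Z) = blocks q (redZone (m·q)
Z)` (`m, q > 0`). [folklore] -/
theorem redZone_closureIdx {m q : ℕ} (hm : 0 < m) (hq : 0 < q) (Z : Finset (Pt d)) :
    redZone m (closureIdx q Z) = blocks q (redZone (m * q) Z) := by
  unfold redZone closureIdx blocks
  rw [image_image, image_image]
  refine image_congr fun x _ => ?_
  funext i
  simp only [Function.comp_apply, blockVec, coarse]
  exact res_coarse hm hq (x i)

/-! ## §2 The reduced S-image of a family lies in the 31-thickened blocking of its reduction -/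

/-- **THE REDUCED `l`-TH S-IMAGE LIES IN THE 31-THICKENED BLOCKING OF THE REDUCED FAMILY**: under drop control of the
exponents read from `j` and `3 ≤ L`, for every modulus `m > 0`,
`redZone m (Siter (ratio L (s ∘ (j+·))) l Z) ⊆ thickT m 31 (blocks (Qfrom L s j l) (redZone (m · Qfrom L s j l) Z))`.
[folklore] -/
theorem redZone_Siter_subset_thickT {L : ℕ} (hL : 3 ≤ L) {s : ℕ → ℕ} {j lm l : ℕ}
    (hdrop : DropCtl (fun i => s (j + i)) lm) (hl : l ≤ lm) {m : ℕ} (hm : 0 < m) (Z : Finset (Pt d)) :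
    redZone m (Siter (ratio L fun i => s (j + i)) l Z) ⊆
      thickT m 31 (blocks (Qfrom L s j l) (redZone (m * Qfrom L s j l) Z)) := by
  have hq : 0 < Qfrom L s j l := Qfrom_pos (by omega) s j l
  intro u hu
  have h1 := redZone_mono m (Siter_subset_biUnion_box hL hdrop Z hl) hu
  rw [redZone_biUnion] at h1
  obtain ⟨c, hc, huc⟩ := mem_biUnion.1 h1
  have h2 := redZone_box_subset_thickT hm c 31 huc
  refine thickT_mono m 31 ?_ h2
  -- the reduced coarse centre is a block of the reduced family
  have h3 : redZone m {c} ⊆ redZone m (closureIdx (Qfrom L s j l) Z) := redZone_singleton_subset m hc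
  rw [redZone_closureIdx hm hq] at h3
  exact h3

/-! ## §3 At levels: the reduced orbit of a birth region lies in its levelled 31-thickened zone -/

/-- **THE REDUCED ORBIT OF A BIRTH REGION LIES IN ITS LEVELLED ZONE.**  For `3 ≤ L`, `n ≥ 1`, stepwise non-increasing
exponents `s` with drop control on every horizon, `lv := levelOf s K`, and steps `j ≤ t ≤ K`:
`redZone (n·L^{K − lv t}) (orbit L s j Z (t − j)) ⊆ thickT (n·L^{K − lv t}) 31 (blocks (L^{lv t − lv j}) (redZone
(n·L^{K − lv j}) Z))` — the step-`t` S-image of a region born at step `j`, read on the level-`lv t` torus, lies in the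
31-thickening of the levelled blocking of the reduced birth region (`HistoryZonesDropsRegions.regZoneD` of the bare
birth, collar `31`). [folklore] -/
theorem redZone_orbit_subset {L : ℕ} (hL : 3 ≤ L) {n : ℕ} (hn : 0 < n) {s : ℕ → ℕ} (hs : ∀ t, s (t + 1) ≤ s t)
    (hdrop : ∀ m, DropCtl s m) {j t K : ℕ} (hjt : j ≤ t) (htK : t ≤ K) (Z : Finset (Pt d)) :
    redZone (n * L ^ (K - levelOf s K t)) (orbit L s j Z (t - j)) ⊆
      thickT (n * L ^ (K - levelOf s K t)) 31
        (blocks (L ^ (levelOf s K t - levelOf s K j)) (redZone (n * L ^ (K - levelOf s K j)) Z)) := by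
  have hL0 : 0 < L := by omega
  have hsK : ∀ u, u < K → s (u + 1) ≤ s u := fun u _ => hs u
  have hLF := levelFn_levelOf hsK (hdrop K)
  have hQ : Qfrom L s j (t - j) = L ^ (levelOf s K t - levelOf s K j) := Qfrom_eq_pow_levelOf_sub hL0 hs hdrop hjt htK
  have hlvt : levelOf s K t ≤ K := hLF.le_K t htK
  have hmono : levelOf s K j ≤ levelOf s K t := hLF.monotone hjt
  have hm : 0 < n * L ^ (K - levelOf s K t) := Nat.mul_pos hn (pow_pos hL0 _)
  have hmq : n * L ^ (K - levelOf s K t) * Qfrom L s j (t - j) = n * L ^ (K - levelOf s K j) := by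
    rw [hQ, mul_assoc, ← pow_add]
    congr 2
    omega
  have h := redZone_Siter_subset_thickT hL (dropCtl_from hdrop j (t - j)) le_rfl hm Z
  rw [hmq, hQ] at h
  exact h

/-! ## §4 Sanity (decided) -/

namespace SanityZO

/-- reduction mod `4` of the box of radius `1` about `5` (one coordinate): `{0, 1, 2}` — inside the `1`-thickening of
`{1}` on `ℤ∕4` -/
example : redZone 4 (box (![5] : Pt 1) 1) = {![0], ![1], ![2]} := by decide

/-- reducing after coarsening = blocking after reducing: `coarse 2` of `7` is `3`, `3 mod 4 = 3`; `7 mod 8 = 7`,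
`7 ∕ 2 = 3` -/
example : redZone 4 (closureIdx 2 ({![7]} : Finset (Pt 1))) = blocks 2 (redZone 8 ({![7]} : Finset (Pt 1))) := by
  decide

end SanityZO

end

end Summit.QuantumFields.BalabanUV.T4Continuum.HistoryZones
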